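import Mathlib
import Summits.NavierStokesRegularity.NavierStokesRegularity.Theorems.TypeILiouvilleSelfSimilarFloorRate
import Summits.NavierStokesRegularity.NavierStokesRegularity.Theorems.TypeILiouvilleQuiescentShadow
import Summits.NavierStokesRegularity.NavierStokesRegularity.Theses.SymmetryModuliCount
import HarnessLib

/-!
# TypeILiouvilleSelfSimilarFloorCore — decomp-ns ROOT CELL, lens 2, generation 22 — PART 3/4 (§3b THE PROFILE, §3c THE CORE)

Part 3 of the node «THE SELF-SIMILAR FLOOR» (description in Part 4 = `Theorems.TypeILiouvilleSelfSimilarFloor`;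
bodies verbatim, shared namespace `…Theorems.TypeILiouvilleSelfSimilarFloor`; needs Part 1 `…Rate` for the floor
`const_of_backward_small_rate`, the rate-`1` emptiness `const_of_typeIRate_lt_one` and the door
`tfl_iff_typeIAncientLiouville`, and the landed `TypeILiouvilleQuiescentShadow.printClass_translate`). Contents:
* §3b THE RESIDUAL ENEMY'S PROFILE: `const_of_eventual_typeIRate_lt_one` — a bounded ancient mild solution whose
  Type-I rate towards a stream `c` is EVENTUALLY below a constant `C < 1` is that stream (time translation +
  the tree's similarity-enstrophy threshold transported to print's class + the floor); so a NON-constant one has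
  `lim sup_{t→−∞} √(−t)·sup_x‖v(t,x) − c‖ ≥ 1` for every stream `c` (and `lim inf ≥ ε₀` by the floor);
* §3c THE DOOR'S OPEN CORE, BY NAME: `typeIAncientLiouville_iff_core` — stmt-NavierStokesRegularity-4050
  `Theses.SymmetryModuliCount.TypeIAncientLiouville` ⟺ «every bounded ancient mild solution (print's class)
  fading towards a stream EVENTUALLY at Type-I rate with a constant `C ≥ 1` IS that stream»; edge
  `typeIAncientLiouville_of_core`. Nothing below the rate `1` is left of the door.
Helper for stmt-NavierStokesRegularity-10661 / stmt-NavierStokesRegularity-4050; nothing here proves NS regularity.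
[cite: KochNadirashviliSereginSverak2009, Prop. 4.1, §4 (i) (arXiv:0709.3599 p. 8)]
-/

noncomputable section

set_option linter.dupNamespace false
set_option maxHeartbeats 800000

open MeasureTheory Set Function Filter
open Literature.Analysis.FluidPDE

namespace Summit.NavierStokesRegularity.NavierStokesRegularity.Theorems.TypeILiouvilleSelfSimilarFloor

/-! ## §3b THE RESIDUAL ENEMY'S PROFILE: eventual rate below `1` is impossible (lim sup ≥ 1) -/

section Profile

/-- **Eventual version of the rate-`1` emptiness.** If the Type-I rate of a P-field towards a stream `c` is
EVENTUALLY (for `t < T`) at most `C < 1`, then `v ≡ c` on all of `t < 0`: translate in time by `T`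
(print's class is invariant under backward translation, `TypeILiouvilleQuiescentShadow.printClass_translate`,
and the weight only improves, `√(−t) ≤ √(−(t+T))`), apply `const_of_typeIRate_lt_one` to the translate, and
propagate the constant past forward by the floor `const_of_backward_small_rate`. CONTRAPOSITIVE (the profile of
the residual enemy): a non-constant bounded ancient mild solution has
`lim sup_{t→−∞} √(−t)·sup_x ‖v(t,x) − c‖ ≥ 1` for EVERY stream `c` (and `lim inf ≥ ε₀` by the floor). -/
theorem const_of_eventual_typeIRate_lt_one :
    ∀ v : ℝ → EuclideanSpace ℝ (Fin 3) → EuclideanSpace ℝ (Fin 3),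
      ContinuousOn (uncurry v) (Iio 0 ×ˢ univ) →
      (∃ K : ℝ, ∀ t < 0, ∀ x, ‖v t x‖ ≤ K) →
      (∀ t < 0, Literature.Analysis.FluidPDE.IsWeaklyDivFree (v t)) →
      (∀ s t : ℝ, s < t → t < 0 → ∀ x,
        v t x = Literature.Analysis.UnboundedOperators.heatExtension (v s) (t - s) x -
          Literature.Analysis.FluidPDE.oseenDuhamel 1 s v v t x) →
      ∀ (c : EuclideanSpace ℝ (Fin 3)) (C : ℝ), C < 1 →
        (∃ T : ℝ, T < 0 ∧ ∀ t < T, ∀ x, Real.sqrt (-t) * ‖v t x - c‖ ≤ C) →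
        ∀ t < 0, ∀ x, v t x = c := by
  intro v hcont hK hdiv hmild c C hC1 hT
  obtain ⟨T, hT0, hC⟩ := hT
  obtain ⟨K, hK'⟩ := hK
  obtain ⟨hc', hK'', hd', hm'⟩ :=
    TypeILiouvilleQuiescentShadow.printClass_translate hcont hK' hdiv hmild hT0.le
      (0 : EuclideanSpace ℝ (Fin 3))
  -- the translate `(t, x) ↦ v (t + T) (x + 0)` has the UNIFORM rate `C`
  have hrate : ∀ t < 0, ∀ x : EuclideanSpace ℝ (Fin 3),
      Real.sqrt (-t) * ‖(fun t x => v (t + T) (x + 0)) t x - c‖ ≤ C := by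
    intro t ht x
    have h1 : Real.sqrt (-t) ≤ Real.sqrt (-(t + T)) := Real.sqrt_le_sqrt (by linarith)
    calc Real.sqrt (-t) * ‖(fun t x => v (t + T) (x + 0)) t x - c‖
        = Real.sqrt (-t) * ‖v (t + T) x - c‖ := by simp only [add_zero]
      _ ≤ Real.sqrt (-(t + T)) * ‖v (t + T) x - c‖ :=
          mul_le_mul_of_nonneg_right h1 (norm_nonneg _)
      _ ≤ C := hC (t + T) (by linarith) x
  have hpast : ∀ t < 0, ∀ x : EuclideanSpace ℝ (Fin 3), (fun t x => v (t + T) (x + 0)) t x = c :=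
    const_of_typeIRate_lt_one (fun t x => v (t + T) (x + 0)) hc' ⟨K, hK''⟩ hd' hm' c C hC1 hrate
  -- forward from the constant past, by the floor (its lim inf hypothesis holds trivially)
  obtain ⟨ε₀, hε₀, hfloor⟩ := const_of_backward_small_rate
  refine hfloor v hcont ⟨K, hK'⟩ hdiv hmild c (fun T' hT' => ⟨min T' T - 1, ?_, fun x => ?_⟩)
  · linarith [min_le_left T' T]
  · have hs : v (min T' T - 1) x = c := by
      have h := hpast (min T' T - 1 - T) (by linarith [min_le_right T' T]) x
      simpa only [sub_add_cancel, add_zero] using h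
    rw [hs, sub_self, norm_zero, mul_zero]
    exact hε₀.le

end Profile

/-! ## §3c THE DOOR'S OPEN CORE: stmt-4050 ⟺ «eventual Type-I fading at a constant ≥ 1 forces the stream» -/

section Core

/-- **TFL ⟺ its core.** The Type-I-rate fading Liouville TFL is equivalent to its restriction to EVENTUAL
Type-I fading (`t < T`) at a constant `C ≥ 1` (conclusion: the field IS the stream): eventual ⟹ global with a
larger constant (the field is bounded on `[T, 0)`), the limit stream is forced (`‖b − c‖ ≤ C/√(−t) → 0`), and
the window `C < 1` is empty by `const_of_eventual_typeIRate_lt_one`. -/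
theorem tfl_iff_core :
    (∀ v : ℝ → EuclideanSpace ℝ (Fin 3) → EuclideanSpace ℝ (Fin 3),
      ContinuousOn (uncurry v) (Iio 0 ×ˢ univ) →
      (∃ K : ℝ, ∀ t < 0, ∀ x, ‖v t x‖ ≤ K) →
      (∀ t < 0, Literature.Analysis.FluidPDE.IsWeaklyDivFree (v t)) →
      (∀ s t : ℝ, s < t → t < 0 → ∀ x,
        v t x = Literature.Analysis.UnboundedOperators.heatExtension (v s) (t - s) x -
          Literature.Analysis.FluidPDE.oseenDuhamel 1 s v v t x) →
      (∃ (c : EuclideanSpace ℝ (Fin 3)) (C : ℝ), ∀ t < 0, ∀ x, Real.sqrt (-t) * ‖v t x - c‖ ≤ C) →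
      ∃ b : EuclideanSpace ℝ (Fin 3), ∀ t < 0, ∀ x, v t x = b) ↔
    (∀ v : ℝ → EuclideanSpace ℝ (Fin 3) → EuclideanSpace ℝ (Fin 3),
      ContinuousOn (uncurry v) (Iio 0 ×ˢ univ) →
      (∃ K : ℝ, ∀ t < 0, ∀ x, ‖v t x‖ ≤ K) →
      (∀ t < 0, Literature.Analysis.FluidPDE.IsWeaklyDivFree (v t)) →
      (∀ s t : ℝ, s < t → t < 0 → ∀ x,
        v t x = Literature.Analysis.UnboundedOperators.heatExtension (v s) (t - s) x -
          Literature.Analysis.FluidPDE.oseenDuhamel 1 s v v t x) →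
      ∀ (c : EuclideanSpace ℝ (Fin 3)) (C : ℝ), 1 ≤ C →
        (∃ T : ℝ, T < 0 ∧ ∀ t < T, ∀ x, Real.sqrt (-t) * ‖v t x - c‖ ≤ C) →
        ∀ t < 0, ∀ x, v t x = c) := by
  constructor
  · intro hT v hcont hK hdiv hmild c C hC1 hev
    obtain ⟨T, hT0, hC⟩ := hev
    obtain ⟨K, hK'⟩ := hK
    -- eventual rate bound ⟹ global rate bound with the constant `max C (√(−T)·(K + ‖c‖))`
    have hbound : ∀ t < 0, ∀ x,
        Real.sqrt (-t) * ‖v t x - c‖ ≤ max C (Real.sqrt (-T) * (K + ‖c‖)) := by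
      intro t ht x
      by_cases htT : t < T
      · exact (hC t htT x).trans (le_max_left _ _)
      · have htT : T ≤ t := not_lt.1 htT
        have h1 : Real.sqrt (-t) ≤ Real.sqrt (-T) := Real.sqrt_le_sqrt (by linarith)
        have h2 : ‖v t x - c‖ ≤ K + ‖c‖ := by linarith [norm_sub_le (v t x) c, hK' t ht x]
        calc Real.sqrt (-t) * ‖v t x - c‖ ≤ Real.sqrt (-T) * (K + ‖c‖) :=
              mul_le_mul h1 h2 (norm_nonneg _) (Real.sqrt_nonneg _)
          _ ≤ max C (Real.sqrt (-T) * (K + ‖c‖)) := le_max_right _ _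
    obtain ⟨b, hb⟩ := hT v hcont ⟨K, hK'⟩ hdiv hmild ⟨c, _, hbound⟩
    -- the limit stream is forced: `b = c`
    have key : ∀ η : ℝ, 0 < η → ‖b - c‖ ≤ η := by
      intro η hη
      have hCpos : 0 < C := by linarith
      set t : ℝ := min (T - 1) (-((C / η + 1) ^ 2)) with ht_def
      have htT : t < T := by
        have := min_le_left (T - 1) (-((C / η + 1) ^ 2)); linarith
      have ht0 : t < 0 := by linarith
      have hsq : C / η + 1 ≤ Real.sqrt (-t) := by
        have h1 : (C / η + 1) ^ 2 ≤ -t := by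
          have := min_le_right (T - 1) (-((C / η + 1) ^ 2)); linarith
        have hpos : 0 ≤ C / η + 1 := by positivity
        calc C / η + 1 = Real.sqrt ((C / η + 1) ^ 2) := by rw [Real.sqrt_sq hpos]
          _ ≤ Real.sqrt (-t) := Real.sqrt_le_sqrt h1
      have hbC : Real.sqrt (-t) * ‖b - c‖ ≤ C := by
        have h := hC t htT 0
        rwa [hb t ht0 0] at h
      have h2 : (C / η + 1) * ‖b - c‖ ≤ C :=
        (mul_le_mul_of_nonneg_right hsq (norm_nonneg _)).trans hbC
      by_contra hle
      have hlt : η < ‖b - c‖ := not_le.1 hle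
      have h3 : (C / η + 1) * η < (C / η + 1) * ‖b - c‖ := mul_lt_mul_of_pos_left hlt (by positivity)
      have h4 : (C / η + 1) * η = C + η := by field_simp
      linarith
    have hbc : b = c := by
      by_contra hne
      have hd : 0 < ‖b - c‖ := norm_pos_iff.2 (sub_ne_zero.2 hne)
      have := key (‖b - c‖ / 2) (by positivity)
      linarith
    intro t ht x
    rw [hb t ht x, hbc]
  · intro hcore v hcont hK hdiv hmild hI
    obtain ⟨c, C, hC⟩ := hI
    have hev : ∃ T : ℝ, T < 0 ∧ ∀ t < T, ∀ x, Real.sqrt (-t) * ‖v t x - c‖ ≤ C :=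
      ⟨-1, by norm_num, fun t ht x => hC t (by linarith) x⟩
    by_cases hC1 : C < 1
    · exact ⟨c, const_of_eventual_typeIRate_lt_one v hcont hK hdiv hmild c C hC1 hev⟩
    · exact ⟨c, hcore v hcont hK hdiv hmild c C (not_lt.1 hC1) hev⟩

/-- **THE DOOR'S OPEN CORE, BY NAME: stmt-NavierStokesRegularity-4050 ⟺ «every bounded ancient mild solution
fading towards a stream EVENTUALLY at Type-I rate with a constant `C ≥ 1` is that stream».** The rate
window `C < 1` (uniformly, eventually, or along a sequence below `ε₀`) is settled; nothing below `1` is left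
of the door. -/
theorem typeIAncientLiouville_iff_core :
    Theses.SymmetryModuliCount.TypeIAncientLiouville ↔
    (∀ v : ℝ → EuclideanSpace ℝ (Fin 3) → EuclideanSpace ℝ (Fin 3),
      ContinuousOn (uncurry v) (Iio 0 ×ˢ univ) →
      (∃ K : ℝ, ∀ t < 0, ∀ x, ‖v t x‖ ≤ K) →
      (∀ t < 0, Literature.Analysis.FluidPDE.IsWeaklyDivFree (v t)) →
      (∀ s t : ℝ, s < t → t < 0 → ∀ x,
        v t x = Literature.Analysis.UnboundedOperators.heatExtension (v s) (t - s) x -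
          Literature.Analysis.FluidPDE.oseenDuhamel 1 s v v t x) →
      ∀ (c : EuclideanSpace ℝ (Fin 3)) (C : ℝ), 1 ≤ C →
        (∃ T : ℝ, T < 0 ∧ ∀ t < T, ∀ x, Real.sqrt (-t) * ‖v t x - c‖ ≤ C) →
        ∀ t < 0, ∀ x, v t x = c) :=
  tfl_iff_typeIAncientLiouville.symm.trans tfl_iff_core

/-- Edge to the ledger door: the core suffices for stmt-NavierStokesRegularity-4050. -/
theorem typeIAncientLiouville_of_core
    (h : ∀ v : ℝ → EuclideanSpace ℝ (Fin 3) → EuclideanSpace ℝ (Fin 3),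
      ContinuousOn (uncurry v) (Iio 0 ×ˢ univ) →
      (∃ K : ℝ, ∀ t < 0, ∀ x, ‖v t x‖ ≤ K) →
      (∀ t < 0, Literature.Analysis.FluidPDE.IsWeaklyDivFree (v t)) →
      (∀ s t : ℝ, s < t → t < 0 → ∀ x,
        v t x = Literature.Analysis.UnboundedOperators.heatExtension (v s) (t - s) x -
          Literature.Analysis.FluidPDE.oseenDuhamel 1 s v v t x) →
      ∀ (c : EuclideanSpace ℝ (Fin 3)) (C : ℝ), 1 ≤ C →
        (∃ T : ℝ, T < 0 ∧ ∀ t < T, ∀ x, Real.sqrt (-t) * ‖v t x - c‖ ≤ C) →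
        ∀ t < 0, ∀ x, v t x = c) :
    Theses.SymmetryModuliCount.TypeIAncientLiouville :=
  typeIAncientLiouville_iff_core.2 h

end Core

end Summit.NavierStokesRegularity.NavierStokesRegularity.Theorems.TypeILiouvilleSelfSimilarFloor

end
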